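import Summits.ResolutionOfSingularities.ResolutionOfSingularities.Theorems.FactorContactClasses
import Summits.ResolutionOfSingularities.ResolutionOfSingularities.Theorems.WeightDescentKernels
import HarnessLib

/-!
# FactorContactKernels — decomp-res node «FactorContact» (lens-4 g17; CRITIC-LEDGER row 114 CLEARED:
DECIDED-MOD-PORT +1 cell)
refining the MaxContactCut aside 32260 (host of the lens-4 column).  Tree file 2/3 of the node.

Content VERBATIM from the decomp-res lens-4 cumulative file `HOME/decomp-res-lens-4/g18/CouplingCut.lean` (sha256
5bf7b2ca8f7311e8;
its §1–§6 = g14 HugValuationCut, ALREADY in the tree as `Theorems/HugValuationCut{Chains,Classes,Kernels}` +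
`MaxContactCutHugValuationCut`; §7–§12 = g15 «MarkingBudget» @369c12ac; §13–§17 = g16 «WeightDescent»
@1cb1c32f; §18–§23 = g17
«FactorContact» @daf245ab; §24–§31 = g18 «CouplingCut»).  HOME = run/shared/lean/pub/decomp-res.

Route-independent, cone-free: §21 KERNELS (PROVED) — the exact cut of g16's located residual (L,P,drift) and of
the impure principal column
by factor tameness (`drifting_iff_tame_wild`, `impure_iff_tame_wild`), the tame cells from the port (`tameDrifting_of_port`,
`tameImpure_of_port`), the in-locus column at weight `n` from the g17 residual and lower weights
(`singularSurface_iff_g17`, `ftt_step_of_g17`);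
§22 port-level all-weights kernels; §23 the codimension-two cell (L,¬P) cut by the EMBEDDING DIMENSION of the
hug: SHALLOW (`topOrder = 1`,
DECIDED-MOD-PORT `ShallowContactPort`) versus DEEP (`HugShadow.Deep`, `2 ≤ topOrder`; class `NoDeepNonPrincipalTowers`).

[WRITER NOTE (decomp-res writer g6): the whole lens-4 chain lives in ONE namespace `…Theorems.HugValuationCut` (the tree's g14
namespace) so that the lens's `HugChain.`/`HugShadow.`/`MarkedShadow.` dot-notation extends the landed structures
verbatim; the lens's
`noTower_iff_perfect_and_imperfect` is the tree's `ContactShadowKernels.noTower_iff_columns`; `set_option` lines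
dropped; cone-free
(no `Theses` import) so the route file can import it for asides; the BY-NAME wiring to the MaxContactCut items is in the
`MaxContactCut<Node>` companion files.]
(Sources: CossartJannsenSaito2020 Key Thm. 6.40, Cor. 6.37, Lem. 6.35/6.36; BierstoneGrigorievMilmanWlodarczyk2011
§3 (marked ideals, Lem. 3.2.1, §3.7); CossartPiltant2019; Abhyankar1956; Cutkosky2009 §2.1; Giraud1975
(Diff-lemma); EGAIV4 §16.8.)
-/

noncomputable section

open CategoryTheory AlgebraicGeometry IsLocalRing
open Literature.AlgebraicGeometry.Resolution
open Summit.ResolutionOfSingularities.ResolutionOfSingularities.Theorems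
open WeakOrderReduction ForcedTowerClasses DivergentTowerClasses MonomialTowerClasses
open HugDimensionClasses HugDimensionKernels SurfaceShadowClasses SurfaceShadowKernels
open ContactShadowClasses (NoTowerImperfect)
open ContactShadowKernels (noTowerImperfect_of_noTower noTowerImperfect_mono noTower_iff_columns)
open NearPointCut (SingularClass singularSurface_iff_noTower)
open AbsoluteContactClasses (IsAbsContactAt)

namespace Summit.ResolutionOfSingularities.ResolutionOfSingularities.Theorems.HugValuationCut

variable {K : Type} [Field K]

/-! ## §21 (g17 · NEW) Kernels (PROVED) -/

/-- **KERNEL — THE EXACT TAMENESS CUT of g16's located residual, PORT-FREE, pure logic**: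
`(L,P,drift) ⟺ (L,P,drift,tame) ∧ (L,P,drift,wild)`. [folklore] -/
theorem drifting_iff_tame_wild {n : ℕ} :
    DriftingTowersTerminate n ↔ TameDriftingTowersTerminate n ∧ WildDriftingTowersTerminate n := by
  refine ⟨fun h => ⟨noTower_mono (fun _ h' => ?_) h, noTower_mono (fun _ h' => ?_) h⟩, ?_⟩
  · obtain ⟨hS, hL, S, hP, hnp, hD, -⟩ := h'
    exact ⟨hS, hL, S, hP, hnp, hD⟩
  · obtain ⟨hS, hL, S, hP, hnp, hD, -⟩ := h'
    exact ⟨hS, hL, S, hP, hnp, hD⟩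
  · rintro ⟨h₁, h₂⟩ p hp k _ _ T g hB hD hE ⟨hS, hL, S, hP, hnp, hDr⟩
    rcases S.factorTame_or_biWild n with hT | hW
    · exact h₁ p hp k T g hB hD hE ⟨hS, hL, S, hP, hnp, hDr, hT⟩
    · exact h₂ p hp k T g hB hD hE ⟨hS, hL, S, hP, hnp, hDr, hW⟩

/-- the impure principal column is exactly its tame and wild slabs (pure logic). [folklore] -/
theorem impure_iff_tame_wild {n : ℕ} :
    (NoTower n fun T => SingularClass T ∧ InLocusShadow T ∧ ∃ S : HugShadow T, S.Principal ∧ ¬ S.Pure n) ↔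
      TameImpureTowersTerminate n ∧ WildImpureTowersTerminate n := by
  refine ⟨fun h => ⟨noTower_mono (fun _ h' => ?_) h, noTower_mono (fun _ h' => ?_) h⟩, ?_⟩
  · obtain ⟨hS, hL, S, hP, hnp, -⟩ := h'
    exact ⟨hS, hL, S, hP, hnp⟩
  · obtain ⟨hS, hL, S, hP, hnp, -⟩ := h'
    exact ⟨hS, hL, S, hP, hnp⟩
  · rintro ⟨h₁, h₂⟩ p hp k _ _ T g hB hD hE ⟨hS, hL, S, hP, hnp⟩
    rcases S.factorTame_or_biWild n with hT | hW
    · exact h₁ p hp k T g hB hD hE ⟨hS, hL, S, hP, hnp, hT⟩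
    · exact h₂ p hp k T g hB hD hE ⟨hS, hL, S, hP, hnp, hW⟩

/-- the wild drifting cell is a sub-cell of the wild slab and of g16's residual (pure logic). [folklore] -/
theorem wildDrifting_of_wildImpure {n : ℕ} (h : WildImpureTowersTerminate n) : WildDriftingTowersTerminate n :=
  noTower_mono (fun _ ⟨hS, hL, S, hP, hnp, _, hW⟩ => ⟨hS, hL, S, hP, hnp, hW⟩) h

/-- Necessity, PORT-FREE: g16's residual implies both g17 cells. [folklore] -/
theorem wildDrifting_of_drifting {n : ℕ} (h : DriftingTowersTerminate n) : WildDriftingTowersTerminate n :=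
  (drifting_iff_tame_wild.mp h).2

/-- **KERNEL — THE TAME SLAB IS EMPTY modulo the factor contact port**: a factor-tame impure principal in-locus tower
hugs a regular surface (port), which the singular class forbids. [folklore] -/
theorem tameImpure_of_port {n : ℕ} (hFC : FactorContactPort n) : TameImpureTowersTerminate n := by
  intro p hp k _ _ T g hB hD hE hT
  obtain ⟨hS, hL, S, hP, hnp, j, ν, hst, hTame⟩ := hT
  exact hS.2.2.2 (hFC p hp k T g hB hD hE S (hL.2 S) hP j ν hst (hTame.imp_right fun h => ⟨hnp, h⟩))

/-- **KERNEL — THE TAME DRIFTING CELL IS EMPTY modulo the port.** [folklore] -/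
theorem tameDrifting_of_port {n : ℕ} (hFC : FactorContactPort n) : TameDriftingTowersTerminate n :=
  noTower_mono (fun _ ⟨hS, hL, S, hP, hnp, _, hT⟩ => ⟨hS, hL, S, hP, hnp, hT⟩) (tameImpure_of_port hFC)

/-- **KERNEL — g16's located residual (L,P,drift) from the port and the WILD residual alone.** [folklore] -/
theorem drifting_of_g17 {n : ℕ} (hFC : FactorContactPort n) (hW : WildDriftingTowersTerminate n) :
    DriftingTowersTerminate n :=
  drifting_iff_tame_wild.mpr ⟨tameDrifting_of_port hFC, hW⟩

/-- **EXACT RE-LOCATION modulo the port: (L,P,drift) ⟺ (L,P,drift,wild).** [folklore] -/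
theorem drifting_iff_wild_of_port {n : ℕ} (hFC : FactorContactPort n) :
    DriftingTowersTerminate n ↔ WildDriftingTowersTerminate n :=
  ⟨wildDrifting_of_drifting, drifting_of_g17 hFC⟩

/-- the g16 factor-isolated cell also loses its tame slab (display: what remains for the weight induction is
factor-isolated ∧ bi-wild). [folklore] -/
theorem factorIsolated_iff_wild_of_port {n : ℕ} (hFC : FactorContactPort n) :
    FactorIsolatedTowersTerminate n ↔
      NoTower n fun T => SingularClass T ∧ InLocusShadow T ∧
        ∃ S : HugShadow T, S.Principal ∧ ¬ S.Pure n ∧ S.FactorIsolated n ∧ S.BiWild n := by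
  refine ⟨fun h => noTower_mono (fun _ ⟨hS, hL, S, hP, hnp, hF, _⟩ => ⟨hS, hL, S, hP, hnp, hF⟩) h, ?_⟩
  intro h p hp k _ _ T g hB hD hE ⟨hS, hL, S, hP, hnp, hF⟩
  rcases S.factorTame_or_biWild n with hT | hW
  · exact tameImpure_of_port hFC p hp k T g hB hD hE ⟨hS, hL, S, hP, hnp, hT⟩
  · exact h p hp k T g hB hD hE ⟨hS, hL, S, hP, hnp, hF, hW⟩

/-- Necessity at the target, PORT-FREE: 32260 at weight `n` implies the wild residual. [folklore] -/
theorem wildDrifting_of_singularSurface {n : ℕ} (h : SingularSurfaceHuggingTowersTerminate n) :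
    WildDriftingTowersTerminate n :=
  wildDrifting_of_drifting (cells_of_singularSurface h).2.2.2

/-- **KERNEL — THE TARGET LEAF 32260 at weight `n`** from g15's (O), g16's (L,¬P) and (L,P,pure), the g17 WILD
residual, the four COSTUME ports and the lower weights. [folklore] -/
theorem singularSurface_of_g17 {n : ℕ} (hP : ShadowPort n) (hM : MarkingPort n) (hDesc : DescentPort n)
    (hFC : FactorContactPort n) (hlow : ∀ n' : ℕ, 1 ≤ n' → n' < n → ForcedTowersTerminate n')
    (hO : OffLocusShadowTowersTerminate n) (hNP : NonPrincipalInLocusTowersTerminate n)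
    (hPu : PurePrincipalTowersTerminate n) (hW : WildDriftingTowersTerminate n) :
    SingularSurfaceHuggingTowersTerminate n :=
  singularSurface_of_g16 hP hM hDesc hlow hO hNP hPu (drifting_of_g17 hFC hW)

/-- **EXACT at weight `n` below a terminating range** (ports + lower weights): 32260 at `n` ⟺ (O) ∧ (L,¬P) ∧
(L,P,pure) ∧ (L,P,drift,WILD). [folklore] -/
theorem singularSurface_iff_g17 {n : ℕ} (hP : ShadowPort n) (hM : MarkingPort n) (hDesc : DescentPort n)
    (hFC : FactorContactPort n) (hlow : ∀ n' : ℕ, 1 ≤ n' → n' < n → ForcedTowersTerminate n') :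
    SingularSurfaceHuggingTowersTerminate n ↔ OffLocusShadowTowersTerminate n ∧
      NonPrincipalInLocusTowersTerminate n ∧ PurePrincipalTowersTerminate n ∧ WildDriftingTowersTerminate n :=
  ⟨fun h => ⟨(pieces_of_singularSurface_g15 h).2.1, (cells_of_singularSurface h).1, (cells_of_singularSurface h).2.1,
    wildDrifting_of_singularSurface h⟩, fun h => singularSurface_of_g17 hP hM hDesc hFC hlow h.1 h.2.1 h.2.2.1 h.2.2.2⟩

/-- **KERNEL — the ROOT PIECE at weight `n`** from the leaves at weight `n` and all lower weights (the step of the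
strong induction, g16's `ftt_step_of_g16` with the drifting cell replaced by port + wild residual). [folklore] -/
theorem ftt_step_of_g17 {n : ℕ} (hn : 1 ≤ n) (hMo : MonomialCorner n) (hC : CurveLaw n) (hSL : SurfaceLaw n)
    (hH : HypersurfaceHuggingTowersTerminate n) (hP : ShadowPort n) (hM : MarkingPort n) (hDesc : DescentPort n)
    (hFC : FactorContactPort n) (hO : OffLocusShadowTowersTerminate n) (hNP : NonPrincipalInLocusTowersTerminate n)
    (hPu : PurePrincipalTowersTerminate n) (hW : WildDriftingTowersTerminate n)
    (hlow : ∀ n' : ℕ, 1 ≤ n' → n' < n → ForcedTowersTerminate n') : ForcedTowersTerminate n :=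
  ftt_step_of_g16 hn hMo hC hSL hH hP hM hDesc hO hNP hPu (drifting_of_g17 hFC hW) hlow

/-! ## §22 (g17) port-level all-weights kernels -/

/-- the tame cell over all weights from the port over all weights. [folklore] -/
theorem noTameDriftingTowers_of_port (hFC : FactorContactPortAll) : NoTameDriftingTowers :=
  fun n hn => tameDrifting_of_port (hFC n hn)

/-- g16's residual over all weights from the port and the wild residual. [folklore] -/
theorem noDriftingTowers_of_g17 (hFC : FactorContactPortAll) (hW : NoWildDriftingTowers) : NoDriftingTowers :=
  fun n hn => drifting_of_g17 (hFC n hn) (hW n hn)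

/-! ## §23 (g17 · NEW) The codimension-two cell (L,¬P) cut by the EMBEDDING DIMENSION of the hug: SHALLOW hugs are
CONTACT hugs (edge to the tree leaf 31571 BY NAME), DEEP hugs are the located codimension-two residual -/

namespace HugShadow

variable {T : ForcedTower} (S : HugShadow T)

/-- **SHALLOW shadow**: at SOME stage the ideal of the strict transform `Σ_j` of the hugged germ has ORDER ONE at the
marked point — `𝓘(Σ_j)_{x_j} ⊄ 𝔪²_{x_j}`: the germ lies inside a REGULAR HYPERSURFACE germ `V(z) ∋
x_j`, `z ∈ 𝓘(Σ_j)_{x_j}`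
a regular parameter (embedding dimension of `Σ_j` at `x_j` below the ambient dimension).  On a PRINCIPAL shadow this
says `Σ_j` is regular at `x_j` (excluded in the singular class by the dictionary `regular`); on a codimension-two shadow
(d = 4) it says the hugged surface sits in a regular threefold germ. -/
def Shallow : Prop :=
  ∃ j : ℕ, S.topOrder j = 1

/-- **DEEP shadow**: at EVERY stage `𝓘(Σ_j)_{x_j} ⊆ 𝔪²_{x_j}` (order `≥ 2`, i.e. `≠ 1` given `≥ 1`):
the hugged surface has
FULL embedding dimension at every marked point, for ever — no regular hypersurface germ ever contains it. -/
def Deep : Prop :=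
  ∀ j : ℕ, S.topOrder j ≠ 1

/-- pure logic. [folklore] -/
theorem not_shallow_iff_deep : ¬ S.Shallow ↔ S.Deep :=
  not_exists

/-- excluded middle on the embedding-dimension axis. [folklore] -/
theorem shallow_or_deep : S.Shallow ∨ S.Deep :=
  (Classical.em S.Shallow).imp_right S.not_shallow_iff_deep.mp

/-- a deep shadow has top order `≥ 2` at every stage (`ν_j ≥ 1` always, `one_le_topOrder`). [folklore] -/
theorem Deep.two_le_topOrder {S : HugShadow T} (h : S.Deep) (j : ℕ) : 2 ≤ S.topOrder j := by
  have h1 : 1 ≤ S.topOrder j := S.one_le_topOrder j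
  have hne : S.topOrder j ≠ 1 := h j
  generalize S.topOrder j = a at h1 hne ⊢
  induction a using ENat.recTopCoe with
  | top => exact le_top
  | coe a =>
    have h1' : 1 ≤ a := by exact_mod_cast h1
    have hne' : a ≠ 1 := fun h' => hne (by simp [h'])
    exact_mod_cast (show 2 ≤ a by omega)

end HugShadow

/-- **CELL (L,¬P,shallow) · RE-LOCATED INTO THE TREE LEAF 31571 BY NAME (`shallowNonPrincipal_of_contact`, modulo
the COSTUME port `ShallowContactPort`) · UNDECIDED there (ATTACKABLE: dim-3 shadow on the hugged regular threefold,
critic row 52 caveat)**: in-locus singular-class towers with no principal shadow, SOME shadow shallow — the hugged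
codimension-two surface lies, at some stage, inside a regular threefold germ, which is then hugged: PERMANENT CONTACT. -/
def ShallowNonPrincipalTowersTerminate (n : ℕ) : Prop :=
  NoTower n fun T => SingularClass T ∧ InLocusShadow T ∧ (∀ S : HugShadow T, ¬ S.Principal) ∧
    ∃ S : HugShadow T, S.Shallow

/-- **CELL (L,¬P,deep) = THE LOCATED CODIMENSION-TWO RESIDUAL · UNDECIDED · IDEA-NEEDED (d = 4)**: in-locus
singular-class towers with no principal shadow, EVERY shadow deep — the hugged surface `Σ_j ⊂ St_j` (fourfold) has
embedding dimension four at every marked point for ever (`𝓘(Σ_j)_{x_j} ⊆ 𝔪²`), and `I_j ⊆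
𝓘(Σ_j)_{x_j} ⊆ 𝔪²`. -/
def DeepNonPrincipalTowersTerminate (n : ℕ) : Prop :=
  NoTower n fun T => SingularClass T ∧ InLocusShadow T ∧ (∀ S : HugShadow T, ¬ S.Principal) ∧
    ∀ S : HugShadow T, S.Deep

/-- **KERNEL — THE EXACT EMBEDDING-DIMENSION CUT of g16's cell (L,¬P), PORT-FREE, pure logic**:
`(L,¬P) ⟺ (L,¬P,shallow) ∧ (L,¬P,deep)`. [folklore] -/
theorem nonPrincipal_iff_shallow_deep {n : ℕ} :
    NonPrincipalInLocusTowersTerminate n ↔ ShallowNonPrincipalTowersTerminate n ∧ DeepNonPrincipalTowersTerminate n := by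
  refine ⟨fun h => ⟨noTower_mono (fun _ h' => ⟨h'.1, h'.2.1, h'.2.2.1⟩) h,
    noTower_mono (fun _ h' => ⟨h'.1, h'.2.1, h'.2.2.1⟩) h⟩, ?_⟩
  rintro ⟨h₁, h₂⟩ p hp k _ _ T g hB hD hE ⟨hS, hL, hNP⟩
  by_cases hsh : ∃ S : HugShadow T, S.Shallow
  · exact h₁ p hp k T g hB hD hE ⟨hS, hL, hNP, hsh⟩
  · exact h₂ p hp k T g hB hD hE ⟨hS, hL, hNP, fun S => S.not_shallow_iff_deep.mp fun h' => hsh ⟨S, h'⟩⟩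

/-- **PORT `ShallowContactPort n` — COSTUME (re-indexing only; paper proof (S1)–(S2) of the module docstring): the
order-ONE strict transform `Σ_j` of a shallow shadow is itself an order-one germ hugged from stage `m + j`
(`strictIter T (m+j) Σ_j i = strictIter T m Σ (j+i)` transported along `m + (j+i) = (m+j) + i`), i.e. a `ContactHugging`
witness `(m + j, Σ_j)`.** -/
def ShallowContactPort (n : ℕ) : Prop :=
  ∀ p : ℕ, p.Prime → ∀ (k : Type) [Field k] [CharP k p] (T : ForcedTower) (g : T.St 0 ⟶ Spec (.of k)),
    IsBase (T.St 0) g → IsDatum n (T.D 0) → (T.D 0).boundary = [] →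
      ∀ S : HugShadow T, S.Shallow → ContactHugging T

/-- **KERNEL — THE SHALLOW CELL FROM THE TREE LEAF `ContactHuggingTowersTerminate n` (31571 at weight `n`) modulo the
COSTUME port**: a shallow hug is a permanent contact. [folklore] -/
theorem shallowNonPrincipal_of_contact {n : ℕ} (hSh : ShallowContactPort n) (hCo : ContactHuggingTowersTerminate n) :
    ShallowNonPrincipalTowersTerminate n := by
  intro p hp k _ _ T g hB hD hE hT
  obtain ⟨-, -, -, S, hS⟩ := hT
  exact hCo p hp k T g hB hD hE (hSh p hp k T g hB hD hE S hS)

/-- **KERNEL — g16's cell (L,¬P) from the tree leaf 31571, the COSTUME port and the DEEP residual.** [folklore] -/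
theorem nonPrincipal_of_g17 {n : ℕ} (hSh : ShallowContactPort n) (hCo : ContactHuggingTowersTerminate n)
    (hDeep : DeepNonPrincipalTowersTerminate n) : NonPrincipalInLocusTowersTerminate n :=
  nonPrincipal_iff_shallow_deep.mpr ⟨shallowNonPrincipal_of_contact hSh hCo, hDeep⟩

/-- Necessity, port-free: (L,¬P) implies the deep residual. [folklore] -/
theorem deepNonPrincipal_of_nonPrincipal {n : ℕ} (h : NonPrincipalInLocusTowersTerminate n) :
    DeepNonPrincipalTowersTerminate n :=
  (nonPrincipal_iff_shallow_deep.mp h).2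

/-- The shallow contact port and the deep residual over all weights. -/
def ShallowContactPortAll : Prop := ∀ n : ℕ, 1 ≤ n → ShallowContactPort n

/-- The located codimension-two residual over all weights. -/
def NoDeepNonPrincipalTowers : Prop := ∀ n : ℕ, 1 ≤ n → DeepNonPrincipalTowersTerminate n

end Summit.ResolutionOfSingularities.ResolutionOfSingularities.Theorems.HugValuationCut
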